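import Summits.RiemannHypothesis.RiemannHypothesis.Theses.OddSector
import Literature.NumberTheory.LFunctions.WeilOddGroundState
import Literature.NumberTheory.LFunctions.WeilGroundEnergyParitySplit
import Literature.NumberTheory.LFunctions.YoshidaOddCriterion
import Literature.NumberTheory.LFunctions.ZetaRealAxis
import Literature.NumberTheory.LFunctions.GeneralizedRH
import Summits.RiemannHypothesis.RiemannHypothesis.Theorems.RuelleBandExactFirstBandStubOddSectorCriterion

/-!
# Crux attack on `OddSector.OddBartaFloor` (stmt-RiemannHypothesis-17779) — the logical shape

Refuter evidence (crux-attack, refuter-rattack-stmt-RiemannHypothesis-17779-0, 2026-08-17).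
Kernel-checked bookkeeping, no analysis:

* `oddBartaFloor_iff` — the crux is LITERALLY (`Iff.rfl`) the statement over the Literature
  vocabulary `IsWeilOddGroundState` / `IsWeilTest` / `weilQuadratic`.
* `oddBartaFloor_of_not_oddOneSignedWindows` — if the thesis crux `OddOneSignedWindows` FAILS
  (one-signed odd bottom states live on a bounded set of windows) the crux holds VACUOUSLY
  (`e ≡ 0`, `a₀` beyond the last good window).
* `oddBartaFloor_of_riemannHypothesis` — `S → C`: under RH the crux holds with `e ≡ 0`
  (proved "if" half of Yoshida / Weil, `yoshida_odd_criterion_mp`).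
* `oddWindowPositivity_of_oddBartaFloor` — `C ∧ X → ` odd-sector Weil positivity on EVERY
  window (monotonicity of the window class + `e → 0`; this is 2001 Cor. A verbatim).
* `oddBartaFloor_iff_imp` — HENCE THE CRUX IS EQUIVALENT TO THE IMPLICATION
  `OddOneSignedWindows → (odd Weil positivity at every window)`; with the odd criterion
  (in tree: Summit-side `stub_oddSectorCriterion`, proved; or Yoshida's named fact) this is
  `OddBartaFloor ↔ (OddOneSignedWindows → RiemannHypothesis)` (`oddBartaFloor_iff_thesis_imp_rh`,
  axioms standard), and also `↔` the same statement with the floor function frozen to `e ≡ 0`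
  (`oddBartaFloor_iff_zero_floor`): the `∃ e → 0, ∃ a₀` dressing carries no content.

Reading: the filed crux types 2001 results Cor. A ("one-signed lowest odd eigenfunctions at
unbounded cutoffs imply `ε_od ≥ 0` everywhere"), not the per-window Barta inequality Thm. B(iii)
(`E ≥ -e^od_a` with the EXPLICIT `e^od_a ≤ e₁(x) + e₂(a)`), because `e` is only existentially /
asymptotically constrained. Consequences: (i) `¬C ↔ (X ∧ ¬RH)` — no refutation short of `¬RH`
AND a construction of one-signed odd bottom states on unbounded windows; (ii) no finite
computation and no single window can falsify `C`; (iii) `C` is also PROVED by any refutation of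
the thesis `X`. The RH-free content the planner intends (Thm. B) is a strictly stronger,
per-window statement with an explicit floor; see the note on the item.
-/

noncomputable section
set_option linter.dupNamespace false

namespace Summit.RiemannHypothesis.RiemannHypothesis.Cruxes.OddBartaFloor.Attack

open Filter Set MeasureTheory
open Literature.NumberTheory.LFunctions
open Summit.RiemannHypothesis.RiemannHypothesis.Theses.OddSector

/-- A window `a` is GOOD when it carries a one-signed odd bottom state (the hypothesis clause of
the crux, = the `∃ u` clause of `OddOneSignedWindows`). -/
def GoodWindow (a : ℝ) : Prop :=
  ∃ u : ℝ → ℂ, IsWeilOddGroundState a u ∧ (∀ᵐ t : ℝ, t ∈ Ioo 0 a → (u t).im = 0 ∧ 0 ≤ (u t).re)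

/-- Odd-sector Weil positivity on every window, in the normalised form used by the crux. -/
def OddWindowPositivity : Prop :=
  ∀ a : ℝ, ∀ h : ℝ → ℂ, IsWeilTest h → tsupport h ⊆ Icc (-a) a → (∀ t, h (-t) = -h t) →
    ∫ t, ‖h t‖ ^ 2 = (1 : ℝ) → 0 ≤ (weilQuadratic h).re

/-- The thesis crux over the Literature vocabulary (definitional). -/
theorem oddOneSignedWindows_iff :
    OddOneSignedWindows ↔ ∀ A : ℝ, ∃ a : ℝ, A ≤ a ∧ GoodWindow a :=
  Iff.rfl

/-- The crux over the Literature vocabulary (definitional). -/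
theorem oddBartaFloor_iff :
    OddBartaFloor ↔
      ∃ e : ℝ → ℝ, Tendsto e atTop (nhds 0) ∧ ∃ a₀ : ℝ, ∀ a : ℝ, a₀ ≤ a → GoodWindow a →
        ∀ h : ℝ → ℂ, IsWeilTest h → tsupport h ⊆ Icc (-a) a → (∀ t, h (-t) = -h t) →
          ∫ t, ‖h t‖ ^ 2 = (1 : ℝ) → -e a ≤ (weilQuadratic h).re :=
  Iff.rfl

/-- `¬X → C`: if good windows are bounded the crux holds vacuously. -/
theorem oddBartaFloor_of_not_oddOneSignedWindows (hX : ¬ OddOneSignedWindows) : OddBartaFloor := by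
  rw [oddBartaFloor_iff]
  rw [oddOneSignedWindows_iff] at hX
  push Not at hX
  obtain ⟨A, hA⟩ := hX
  exact ⟨fun _ ↦ 0, tendsto_const_nhds, A, fun a ha hgood ↦ absurd hgood (hA a ha)⟩

/-- Odd window positivity gives the crux with the zero floor. -/
theorem oddBartaFloor_of_oddWindowPositivity (hpos : OddWindowPositivity) : OddBartaFloor := by
  rw [oddBartaFloor_iff]
  refine ⟨fun _ ↦ 0, tendsto_const_nhds, 0, fun a _ _ h hh hs hodd hnorm ↦ ?_⟩
  rw [neg_zero]
  exact hpos a h hh hs hodd hnorm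

/-- `S → C`: under RH the crux holds (with `e ≡ 0`), by the proved easy half of Yoshida / Weil. -/
theorem oddBartaFloor_of_riemannHypothesis (hRH : RiemannHypothesis) : OddBartaFloor :=
  oddBartaFloor_of_oddWindowPositivity fun _ h hh _ hodd _ ↦ yoshida_odd_criterion_mp hRH h hh hodd

/-- `C ∧ X →` odd Weil positivity on EVERY window (2001 Cor. A: monotonicity of the window class
and `e → 0` along the unbounded good set). -/
theorem oddWindowPositivity_of_oddBartaFloor (hC : OddBartaFloor) (hX : OddOneSignedWindows) :
    OddWindowPositivity := by
  rw [oddBartaFloor_iff] at hC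
  rw [oddOneSignedWindows_iff] at hX
  obtain ⟨e, he, a₀, hfloor⟩ := hC
  intro b h hh hs hodd hnorm
  by_contra hneg
  push Not at hneg
  have hev : ∀ᶠ a in atTop, e a < -(weilQuadratic h).re :=
    he.eventually (Iio_mem_nhds (by linarith))
  obtain ⟨A₁, hA₁⟩ := Filter.eventually_atTop.1 hev
  obtain ⟨a, ha, hgood⟩ := hX (max (max b a₀) A₁)
  have hb : b ≤ a := le_trans (le_trans (le_max_left _ _) (le_max_left _ _)) ha
  have ha₀ : a₀ ≤ a := le_trans (le_trans (le_max_right _ _) (le_max_left _ _)) ha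
  have hA₁a : A₁ ≤ a := le_trans (le_max_right _ _) ha
  have hs' : tsupport h ⊆ Icc (-a) a := hs.trans (Icc_subset_Icc (neg_le_neg hb) hb)
  have h1 := hfloor a ha₀ hgood h hh hs' hodd hnorm
  have h2 := hA₁ a hA₁a
  linarith

/-- **The crux is the implication `thesis → odd Weil positivity at every window`.** -/
theorem oddBartaFloor_iff_imp : OddBartaFloor ↔ (OddOneSignedWindows → OddWindowPositivity) :=
  ⟨oddWindowPositivity_of_oddBartaFloor, fun H ↦
    (Classical.em OddOneSignedWindows).elim (fun hX ↦ oddBartaFloor_of_oddWindowPositivity (H hX))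
      oddBartaFloor_of_not_oddOneSignedWindows⟩

/-- **The floor function is decoration**: the crux is equivalent to itself with `e ≡ 0`. -/
theorem oddBartaFloor_iff_zero_floor :
    OddBartaFloor ↔
      ∃ a₀ : ℝ, ∀ a : ℝ, a₀ ≤ a → GoodWindow a →
        ∀ h : ℝ → ℂ, IsWeilTest h → tsupport h ⊆ Icc (-a) a → (∀ t, h (-t) = -h t) →
          ∫ t, ‖h t‖ ^ 2 = (1 : ℝ) → 0 ≤ (weilQuadratic h).re := by
  constructor
  · intro hC
    by_cases hX : OddOneSignedWindows
    · exact ⟨0, fun a _ _ h hh hs hodd hnorm ↦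
        oddWindowPositivity_of_oddBartaFloor hC hX a h hh hs hodd hnorm⟩
    · rw [oddOneSignedWindows_iff] at hX
      push Not at hX
      obtain ⟨A, hA⟩ := hX
      exact ⟨A, fun a ha hgood ↦ absurd hgood (hA a ha)⟩
  · rintro ⟨a₀, h0⟩
    rw [oddBartaFloor_iff]
    refine ⟨fun _ ↦ 0, tendsto_const_nhds, a₀, fun a ha hgood h hh hs hodd hnorm ↦ ?_⟩
    rw [neg_zero]
    exact h0 a ha hgood h hh hs hodd hnorm

/-- Normalised-window odd positivity is odd positivity (`ε_od(a) ≥ 0` for all `a`). -/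
theorem oddWindowPositivity_iff_forall_nonneg :
    OddWindowPositivity ↔ ∀ a : ℝ, 0 ≤ weilOddGroundEnergy a := by
  constructor
  · intro h a
    refine Real.sInf_nonneg ?_
    rintro x ⟨g, hg, hs, hodd, hnorm, rfl⟩
    exact h a g hg hs hodd hnorm
  · intro h a g hg hs hodd _
    exact (weilOddGroundEnergy_nonneg_iff a).1 (h a) g hg hs hodd

/-- … and is Yoshida's "oddly positive definite". -/
theorem oddWindowPositivity_iff_odd :
    OddWindowPositivity ↔
      ∀ g : ℝ → ℂ, IsWeilTest g → (∀ t, g (-t) = -g t) → 0 ≤ (weilQuadratic g).re := by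
  rw [oddWindowPositivity_iff_forall_nonneg]
  constructor
  · intro h g hg hodd
    obtain ⟨a, _, hs⟩ := hg.exists_tsupport_subset_Icc
    exact (weilOddGroundEnergy_nonneg_iff a).1 (h a) g hg hs hodd
  · intro h a
    exact (weilOddGroundEnergy_nonneg_iff a).2 fun g hg _ hodd ↦ h g hg hodd

/-- Odd Weil positivity implies RH, UNCONDITIONALLY in the tree (Summit-side
`stub_oddSectorCriterion`: positivity on odd REAL tests puts every strip zero on the line or the
real axis; no real zeros in `(0,1)`; strip form of RH). -/
theorem riemannHypothesis_of_oddWindowPositivity (hpos : OddWindowPositivity) : RiemannHypothesis := by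
  rw [oddWindowPositivity_iff_odd] at hpos
  have hstrip := Theorems.RuelleBandExactFirstBand.stub_oddSectorCriterion
    (fun g hg hodd _ ↦ hpos g hg hodd)
  refine riemannHypothesis_iff_strip_holds.2 fun s hs h0 h1 ↦ ?_
  rcases hstrip s hs h0 h1 with h | him
  · exact h
  · exfalso
    have hsre : s = ((s.re : ℝ) : ℂ) := by
      apply Complex.ext <;> simp [him]
    rw [hsre] at hs
    exact riemannZeta_ofReal_ne_zero_of_pos_of_lt_one s.re h0 h1 hs

/-- **`C ↔ (X → RH)`, unconditionally**: the crux is exactly the route's glue implication. -/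
theorem oddBartaFloor_iff_thesis_imp_rh :
    OddBartaFloor ↔ (OddOneSignedWindows → RiemannHypothesis) := by
  rw [oddBartaFloor_iff_imp]
  constructor
  · exact fun H hX ↦ riemannHypothesis_of_oddWindowPositivity (H hX)
  · intro H hX
    exact fun _ h hh _ hodd _ ↦ yoshida_odd_criterion_mp (H hX) h hh hodd

/-- The same through the route's own items: given `OddNegativityOffLine` (rank 4; candidate proof
attached by the grounder), `C ↔ (X → Summit)`, the forward direction being the route's `closes`. -/
theorem oddBartaFloor_iff_thesis_imp_summit (hNeg : OddNegativityOffLine) :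
    OddBartaFloor ↔ (OddOneSignedWindows → _root_.Summit.RiemannHypothesis) :=
  ⟨fun hC hX ↦ closes hC hX hNeg, fun H ↦
    (Classical.em OddOneSignedWindows).elim
      (fun hX ↦ oddBartaFloor_of_riemannHypothesis (H hX))
      oddBartaFloor_of_not_oddOneSignedWindows⟩

/-- Consequently the crux is IRREFUTABLE short of `¬RH`: `¬C → X ∧ ¬RH`. -/
theorem not_oddBartaFloor_imp (hC : ¬ OddBartaFloor) : OddOneSignedWindows ∧ ¬ RiemannHypothesis := by
  rw [oddBartaFloor_iff_thesis_imp_rh] at hC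
  push Not at hC
  exact hC

/-! ## Hypothesis mutation (load-bearing analysis, kernel-checked) -/

/-- **Dropping `Tendsto e atTop (𝓝 0)` makes the crux a theorem**: with an unconstrained floor
one takes `e a := -ε_od(a)` (the odd sphere is bounded below, `weilOddGroundEnergy_le`). So the
decay clause is the only constraint on `e`. -/
theorem oddBartaFloor_without_tendsto :
    ∃ e : ℝ → ℝ, ∃ a₀ : ℝ, ∀ a : ℝ, a₀ ≤ a → GoodWindow a →
      ∀ h : ℝ → ℂ, IsWeilTest h → tsupport h ⊆ Icc (-a) a → (∀ t, h (-t) = -h t) →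
        ∫ t, ‖h t‖ ^ 2 = (1 : ℝ) → -e a ≤ (weilQuadratic h).re :=
  ⟨fun a ↦ -weilOddGroundEnergy a, 0, fun a _ _ h hh hs hodd hnorm ↦ by
    rw [neg_neg]; exact weilOddGroundEnergy_le hh hs hodd hnorm⟩

/-- The crux with the one-signed-bottom-state hypothesis DROPPED. -/
def OddBartaFloorWithoutGoodWindow : Prop :=
  ∃ e : ℝ → ℝ, Tendsto e atTop (nhds 0) ∧ ∃ a₀ : ℝ, ∀ a : ℝ, a₀ ≤ a →
    ∀ h : ℝ → ℂ, IsWeilTest h → tsupport h ⊆ Icc (-a) a → (∀ t, h (-t) = -h t) →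
      ∫ t, ‖h t‖ ^ 2 = (1 : ℝ) → -e a ≤ (weilQuadratic h).re

/-- **Dropping the hypothesis `GoodWindow a` turns the crux into RH itself** (monotonicity of the
window class makes "floor `-e(a) → 0` at all large windows" the same as odd positivity at every
window, which is RH by the odd criterion, both halves proved in the tree). So the hypothesis is
load-bearing, and what it buys is exactly the passage from "all large windows" to "the good ones". -/
theorem oddBartaFloorWithoutGoodWindow_iff_rh : OddBartaFloorWithoutGoodWindow ↔ RiemannHypothesis := by
  constructor
  · rintro ⟨e, he, a₀, hfloor⟩
    refine riemannHypothesis_of_oddWindowPositivity fun b h hh hs hodd hnorm ↦ ?_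
    by_contra hneg
    push Not at hneg
    have hev : ∀ᶠ a in atTop, e a < -(weilQuadratic h).re :=
      he.eventually (Iio_mem_nhds (by linarith))
    obtain ⟨A₁, hA₁⟩ := Filter.eventually_atTop.1 hev
    set a := max (max b a₀) A₁ with ha
    have hb : b ≤ a := le_trans (le_max_left _ _) (le_max_left _ _)
    have ha₀ : a₀ ≤ a := le_trans (le_max_right _ _) (le_max_left _ _)
    have hA₁a : A₁ ≤ a := le_max_right _ _
    have hs' : tsupport h ⊆ Icc (-a) a := hs.trans (Icc_subset_Icc (neg_le_neg hb) hb)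
    have h1 := hfloor a ha₀ h hh hs' hodd hnorm
    have h2 := hA₁ a hA₁a
    linarith
  · intro hRH
    exact ⟨fun _ ↦ 0, tendsto_const_nhds, 0, fun a _ h hh _ hodd _ ↦ by
      rw [neg_zero]; exact yoshida_odd_criterion_mp hRH h hh hodd⟩

/-- For the record: odd window positivity IS the Riemann hypothesis (both halves proved in the
tree: `stub_oddSectorCriterion` and `yoshida_odd_criterion_mp`). -/
theorem oddWindowPositivity_iff_rh : OddWindowPositivity ↔ RiemannHypothesis :=
  ⟨riemannHypothesis_of_oddWindowPositivity,
    fun hRH _ h hh _ hodd _ ↦ yoshida_odd_criterion_mp hRH h hh hodd⟩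

end Summit.RiemannHypothesis.RiemannHypothesis.Cruxes.OddBartaFloor.Attack

end
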